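import Summits.HodgeConjecture.HodgeCM.Automorphic.PoissonSummationLattice_1

/-! PORT of `HodgeCM/Automorphic/PoissonSummationLattice.lean` (HodgeCMPerL run 81) — part 2: continuation of `Summits.HodgeConjecture.HodgeCM.Automorphic.PoissonSummationLattice_1` (split at a top-level declaration boundary by port_pkg.py; scope re-opened below; declarations unchanged). -/

-- port_pkg: scope re-opened for this part (file-level context, then the namespace/section stack open at the cut)
set_option autoImplicit false
noncomputable section
open MeasureTheory MeasureTheory.Measure Module Submodule Set ZSpan
open scoped RealInnerProductSpace FourierTransform
namespace HodgeCM
namespace PoissonSummation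
section Periodization
variable {V : Type*} [NormedAddCommGroup V] [InnerProductSpace ℝ V] [FiniteDimensional ℝ V]
variable (L : Submodule ℤ V) [DiscreteTopology L] [IsZLattice ℝ L]
variable {ι : Type*} [Fintype ι] [DecidableEq ι] (b : Basis ι ℤ L)
variable (Φ : SchwartzMap V ℂ)
section Coeff
variable [MeasurableSpace V] [BorelSpace V]
/-- **The Fourier coefficients of the periodisation** are `covol(L)⁻¹ * 𝓕 Φ` at the dual lattice
points. -/
theorem mFourierCoeff_torusMap (n : ι → ℤ) :
    UnitAddTorus.mFourierCoeff (torusMap L b Φ) n =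
      ((ZLattice.covolume L : ℝ) : ℂ)⁻¹ * 𝓕 Φ (dualLatticeEquiv L b n : V) := by
  have hcovol : (0 : ℝ) < ZLattice.covolume L := ZLattice.covolume_pos L volume
  -- Step 1: the coefficient as an integral over the half-open unit cube
  have step1 : UnitAddTorus.mFourierCoeff (torusMap L b Φ) n =
      ∫ s in Set.univ.pi fun _ => Set.Ico (0 : ℝ) 1,
        UnitAddTorus.mFourier (-n) (toTorus s) *
          periodization L Φ ((realBasis L b).equivFunL.symm s) := by
    rw [UnitAddTorus.mFourierCoeff_eq_integral _ n 0]
    have hset : {x : ι → ℝ | ∀ i, x i ∈ Set.Ioc ((0 : ι → ℝ) i) ((0 : ι → ℝ) i + 1)} =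
        Set.univ.pi fun _ => Set.Ioc (0 : ℝ) 1 := by
      ext; simp
    have hae : (Set.univ.pi fun _ => Set.Ioc (0 : ℝ) 1 : Set (ι → ℝ)) =ᵐ[volume]
        (Set.univ.pi fun _ => Set.Ico (0 : ℝ) 1) :=
      (Measure.univ_pi_Ioc_ae_eq_Icc (μ := fun _ : ι => (volume : Measure ℝ))).trans
        (Measure.univ_pi_Ico_ae_eq_Icc (μ := fun _ : ι => (volume : Measure ℝ))).symm
    rw [hset, setIntegral_congr_set hae]
    refine setIntegral_congr_fun (MeasurableSet.univ_pi fun _ => measurableSet_Ico) fun s _ => ?_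
    rw [smul_eq_mul]
    exact congr_arg _ (torusMap_toTorus L b Φ s)
  -- Step 2: change variables to `V`; the cube pulls back to the fundamental domain
  have step2 : ZLattice.covolume L • ∫ s in Set.univ.pi fun _ => Set.Ico (0 : ℝ) 1,
        UnitAddTorus.mFourier (-n) (toTorus s) *
          periodization L Φ ((realBasis L b).equivFunL.symm s) =
      ∫ y in fundamentalDomain (realBasis L b),
        (Real.fourierChar (-⟪y, (dualLatticeEquiv L b n : V)⟫) : ℂ) * periodization L Φ y := by
    rw [covolume_smul_setIntegral_eq L b (fun s => UnitAddTorus.mFourier (-n) (toTorus s) *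
      periodization L Φ ((realBasis L b).equivFunL.symm s)), preimage_equivFunL_pi_Ico]
    refine setIntegral_congr_fun (fundamentalDomain_measurableSet _) fun y _ => ?_
    simp only [ContinuousLinearEquiv.symm_apply_apply, mFourier_toTorus, map_neg,
      Submodule.coe_neg, inner_neg_left, real_inner_comm]
  -- Step 3: unfold over the fundamental domain
  have step3 := setIntegral_fundamentalDomain_fourierChar_mul_periodization L b Φ
    (dualLatticeEquiv L b n)
  have key : ((ZLattice.covolume L : ℝ) : ℂ) * UnitAddTorus.mFourierCoeff (torusMap L b Φ) n =
      𝓕 Φ (dualLatticeEquiv L b n : V) := by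
    rw [step1, ← Complex.real_smul, step2, step3]
  rw [← key, ← mul_assoc, inv_mul_cancel₀ (by exact_mod_cast hcovol.ne'), one_mul]

/-- The Fourier coefficients of the periodisation form a summable family (`𝓕 Φ` is Schwartz and
the dual lattice is a lattice). -/
theorem summable_fourier_dualLatticeEquiv :
    Summable fun n : ι → ℤ => 𝓕 Φ (dualLatticeEquiv L b n : V) := by
  -- (staged on purpose: elaborating `(summable_norm_restrict _ (𝓕 Φ)).of_norm` in one go
  -- against the expected type sends the unifier into the Fourier-transform instances)
  have h₁ : Summable fun w : dualLattice L => ‖𝓕 Φ (w : V)‖ :=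
    PerL34.LatticeTheta.summable_norm_restrict (dualLattice L) (𝓕 Φ)
  have h₂ : Summable fun w : dualLattice L => 𝓕 Φ (w : V) := h₁.of_norm
  have h₃ : Summable ((fun w : dualLattice L => 𝓕 Φ (w : V)) ∘ (dualLatticeEquiv L b)) :=
    h₂.comp_injective (dualLatticeEquiv L b).injective
  exact h₃

/-- (Ported verbatim from the HodgeCMPerL package; no docstring in the source.) -/
theorem summable_mFourierCoeff_torusMap :
    Summable (UnitAddTorus.mFourierCoeff (torusMap L b Φ)) := by
  have : UnitAddTorus.mFourierCoeff (torusMap L b Φ) =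
      fun n => ((ZLattice.covolume L : ℝ) : ℂ)⁻¹ * 𝓕 Φ (dualLatticeEquiv L b n : V) :=
    funext (mFourierCoeff_torusMap L b Φ)
  rw [this]
  exact (summable_fourier_dualLatticeEquiv L b Φ).mul_left _

/-- Poisson summation in coordinates: `HasSum` over `ℤ^ι`. -/
theorem hasSum_fourier_dualLatticeEquiv (x : V) :
    HasSum (fun n : ι → ℤ => 𝓕 Φ (dualLatticeEquiv L b n : V) *
        Real.fourierChar ⟪(dualLatticeEquiv L b n : V), x⟫)
      (((ZLattice.covolume L : ℝ) : ℂ) * periodization L Φ x) := by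
  have hcovol : ((ZLattice.covolume L : ℝ) : ℂ) ≠ 0 := by
    exact_mod_cast (ZLattice.covolume_pos L volume).ne'
  have h := UnitAddTorus.hasSum_mFourier_series_apply_of_summable
    (summable_mFourierCoeff_torusMap L b Φ) (toTorus ((realBasis L b).equivFunL x))
  rw [torusMap_toTorus, ContinuousLinearEquiv.symm_apply_apply] at h
  have h' := h.mul_left ((ZLattice.covolume L : ℝ) : ℂ)
  refine h'.congr_fun fun n => ?_
  rw [mFourierCoeff_torusMap, mFourier_toTorus, smul_eq_mul, ← mul_assoc, ← mul_assoc,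
    mul_inv_cancel₀ hcovol, one_mul]

end Coeff

end Periodization

/-! ### Poisson summation over `L` and its dual lattice -/

section Main

variable {V : Type*} [NormedAddCommGroup V] [InnerProductSpace ℝ V] [FiniteDimensional ℝ V]
  [MeasurableSpace V] [BorelSpace V]
variable (L : Submodule ℤ V) [DiscreteTopology L] [IsZLattice ℝ L]
variable (Φ : SchwartzMap V ℂ)

/-- **Poisson summation, `HasSum` form.** For a Schwartz function `Φ` on a finite-dimensional real
inner product space `V`, a full lattice `L ⊂ V` and `x : V`,
`∑_{w ∈ L*} 𝓕 Φ (w) 𝐞(⟪w, x⟫)` converges to `covol(L) * ∑_{v ∈ L} Φ (x + v)`. -/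
theorem hasSum_fourier_dualLattice (x : V) :
    HasSum (fun w : dualLattice L => 𝓕 Φ (w : V) * Real.fourierChar ⟪(w : V), x⟫)
      (((ZLattice.covolume L : ℝ) : ℂ) * ∑' v : L, Φ (x + (v : V))) := by
  classical
  let b := Module.Free.chooseBasis ℤ L
  have h := hasSum_fourier_dualLatticeEquiv L b Φ x
  rw [periodization] at h
  exact ((dualLatticeEquiv L b).injective.hasSum_iff
    (f := fun w : dualLattice L => 𝓕 Φ (w : V) * Real.fourierChar ⟪(w : V), x⟫)
    (fun w hw => absurd (Set.mem_range.mpr ((dualLatticeEquiv L b).surjective w)) hw)).1 h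

/-- Absolute convergence of the dual side. -/
theorem summable_fourier_dualLattice :
    Summable fun w : dualLattice L => ‖𝓕 Φ (w : V)‖ :=
  PerL34.LatticeTheta.summable_norm_restrict (dualLattice L) (𝓕 Φ)

/-- **Poisson summation over a lattice.** For a Schwartz function `Φ` on a finite-dimensional
real inner product space `V`, a full lattice `L ⊂ V` with dual lattice `L*`, and `x : V`:
`∑_{v ∈ L} Φ (x + v) = covol(L)⁻¹ * ∑_{w ∈ L*} 𝓕 Φ (w) * 𝐞 ⟪w, x⟫`. -/
theorem tsum_lattice_eq_tsum_dualLattice (x : V) :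
    ∑' v : L, Φ (x + (v : V)) =
      ((ZLattice.covolume L : ℝ) : ℂ)⁻¹ *
        ∑' w : dualLattice L, 𝓕 Φ (w : V) * Real.fourierChar ⟪(w : V), x⟫ := by
  have hcovol : ((ZLattice.covolume L : ℝ) : ℂ) ≠ 0 := by
    exact_mod_cast (ZLattice.covolume_pos L volume).ne'
  rw [(hasSum_fourier_dualLattice L Φ x).tsum_eq, ← mul_assoc, inv_mul_cancel₀ hcovol, one_mul]

/-- **Poisson summation over a lattice, at the origin:**
`∑_{v ∈ L} Φ v = covol(L)⁻¹ * ∑_{w ∈ L*} 𝓕 Φ w`. -/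
theorem tsum_lattice_eq_tsum_dualLattice_zero :
    ∑' v : L, Φ (v : V) =
      ((ZLattice.covolume L : ℝ) : ℂ)⁻¹ * ∑' w : dualLattice L, 𝓕 Φ (w : V) := by
  have h := tsum_lattice_eq_tsum_dualLattice L Φ 0
  simp only [zero_add, inner_zero_right, AddChar.map_zero_eq_one, Circle.coe_one, mul_one] at h
  exact h

end Main

end PoissonSummation
end HodgeCM

-- port_pkg: scope closed for this part
end
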